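import Mathlib
import HarnessLib
import HarnessLib.Audit
import Summits.MatrixMultiplication.Statement
import Literature.Combinatorics.Additive.TripleProductProperty
import Literature.Computability.AlgebraicComplexity.CohnUmansTPPProofs
import Literature.RepresentationTheory.FiniteGroups.CharacterDegrees
import HarnessLib.Audit.Status.Attr

/-!
Route: SnSubsetDichotomy

# Route SnSubsetDichotomy — threshold TPP subset triples in S_n give omega = 2 (deciding theorem
proved), or the global/junta dichotomy rules them out

X = THRESHOLD SUBSET TRIPLES (the DECIDING side of the symmetric-group subsets dichotomy is the
target; its negation, the negative
milestone NoThresholdSubsetTriple = ¬X, stays filed as the route's own refutation programme,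
realising card
global-hypercontractivity-tpp-dichotomy — the subsets half of BlasiakChurchCohnGrochowUmans2017 §4's
open question "rule out all triples
of subgroups of S_n, or even all triples of subsets"; the subgroups half is SETTLED NEGATIVELY in
the tree: route SnThresholdCensus closed
`refuted`, `SnThresholdCensusThresholdSubgroupTriples_refuted`, and
`HyperoctahedralThreshold.Negative.subgroup_sieve`): for every c > 0
and every n₀ there are n ≥ n₀ and S, T, U ⊆ S_n with the triple product property (CohnUmans2003 Def.
2.1, the tree's
`TripleProductProperty`) and |S||T||U| > (n!)^{3/2}·e^{−c√n} — TPP subset triples of slack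
e^{−o(√n)} below the packing bound (n!)^{3/2}.
X DECIDES THE SUMMIT: `closes : ThresholdSubsetTriples → VershikKerovBound → MatrixMultiplication`
is PROVED (rev 1, re-certified rev 4)
from the Cohn–Umans inequality CKSU2005 Cor. 1.9, a tree THEOREM
(`Literature.Computability.AlgebraicComplexity.CKSU2005_cor19_holds`),
and the support item VershikKerovBound (d_max(S_n) ≤ √(n!)e^{−c₁√n}, PROVED:
`vershikKerovBound_proof`, the ε := c₂/2 instance of
`Literature.RepresentationTheory.FiniteGroups.VershikKerov1985_maxCharDegree_holds`, c₂ =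
vkUpperConst = (π−2)/π² > 0).
STATE AFTER THE 2026-08-17 REPAIR (revs 5–7): the first knife-edge pair is DECIDED —
HyperoctahedralSubsets (no threshold design inside
three matching centralisers C(μ_i) = B(M_i) ≅ S_2 ≀ S_{n/2}) is PROVED
(`hyperoctahedralSubsets_proof`: 3-wise group packing over a
product-one triple group of order 2^{√n/4} supplied by the matching lemma
`localTriplePacking_holds`) and its push_neg twin, the former
construction crux HyperoctahedralThreshold, is REFUTED (`not_HyperoctahedralThreshold`,
refuted-substantive) and dropped from the
active items (record kept below the items). The constructive side is now carried by the target
itself (its crux lines: triality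
chain products, `Cruxes/ThresholdSubsetTriples/`) and by the negation of the NEXT RUNG, the new crux
SubgroupHostedSubsets: no
threshold TPP subset design lives inside ANY three subgroup hosts H_i ≤ S_n whose orders multiply to
at most (n!)^{3/2}e^{c√n}
(near-threshold hosts: matching centralisers, Young S_λ with ≈ √(n/e) blocks, S_k × B_m mixtures,
large subgroups of S_{n/2} ≀ S_2 and
their index-e^{O(√n)} subgroups); refuting it yields X (support SubgroupHostedEdge, proved in the
planner's Sketch.lean) and hence
ω(ℂ) = 2 through `closes`; proving it settles BCCGU17 §4's question for every group-like host and
pushes any threshold design into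
genuinely non-coset territory. The NEGATIVE SIDE ¬X = NoThresholdSubsetTriple (support
NoThresholdIffNotThreshold: NoThresholdSubsetTriple
↔ ¬X, proved) is reduced (support DichotomyInduction, proved) to the two branches of a
density-increment dichotomy on t-umvirates
U_{I→L} = {σ : σ∘I = L}: GlobalBranch (bump-free triples are sub-threshold) and JuntaBranch (a
super-neutral bump buys a better triple
in a smaller symmetric group); SubgroupHostedSubsets and PolynomialSlack are its next test cases
(NoThresholdSubsetTriple →
SubgroupHostedSubsets, Sketch.lean). A proof of ¬X REFUTES the target and closes the route
`refuted`, with BCCGU17's subsets question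
settled — the informative failure; a proof of X is ω(ℂ) = 2.
Lean: `∀ c : ℝ, 0 < c → ∀ n₀ : ℕ, ∃ n ≥ n₀, ∃ S T U : Finset (Equiv.Perm (Fin n)),
Literature.Combinatorics.Additive.TripleProductProperty S T U ∧ (n.factorial : ℝ) ^ ((3 : ℝ) / 2) *
Real.exp (-(c * Real.sqrt (n : ℝ))) < ((S.card * T.card * U.card : ℕ) : ℝ)`

## Assembly
Deciding theorem (D-0027 §2.1), PROVED (rev 1) and re-certified unchanged at the 2026-08-17 repair
(rev 4):
`theorem closes (hT : ThresholdSubsetTriples) (hVK : VershikKerovBound) : MatrixMultiplication`. By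
`MatrixMultiplication_iff` the
goal is omega ℂ = 2; 2 ≤ ω is the tree's `omega_two_le`. If ω > 2, take c₁, n₁ from
VershikKerovBound and put
c := 3c₁(ω−2)/(2ω) > 0; X yields n ≥ n₁ and a TPP triple with N := |S||T||U| > M :=
(n!)^{3/2}e^{−c√n} > 0; ⟨S,T,U,rfl,rfl,rfl,h⟩ is
`RealizesTPP (Equiv.Perm (Fin n)) |S| |T| |U|`, so `CKSU2005_cor19_holds` gives N^{ω/3} ≤
d_max^{ω−2}·|S_n| with
`Nat.card (Perm (Fin n)) = n!`, and monotonicity (ω − 2 ≥ 0) gives N^{ω/3} ≤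
(√(n!)e^{−c₁√n})^{ω−2}·n!. Logarithms:
(ω/3)(3/2·log n! − c√n) < (ω/3) log N ≤ (ω−2)(½ log n! − c₁√n) + log n!, and since ωc/3 = c₁(ω−2)/2
this says c₁(ω−2)√n/2 < 0 ≤
c₁(ω−2)√n — absurd (nlinarith). Hence ω ≤ 2. The refuted construction crux HyperoctahedralThreshold
was never a hypothesis of `closes`
(it fed X through the ex-support HyperoctahedralToThreshold, dropped with it; that edge survives
inside the proved support
NegativeSideResistance as `thresholdSubsetTriples_of_not_hyperoctahedralSubsets`). OFF the deciding
theorem the negative side composes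
as DichotomyInduction ∘ (GlobalBranch, JuntaBranch) = NoThresholdSubsetTriple = ¬X, which would
refute the target
(NoThresholdIffNotThreshold); every negative-side crux has its NEGATIVE edge to `closes`
(NegativeSideResistance, SubgroupHostedEdge).

Rationale: WHY THIS LINE. TWO-SIDED: the target X = ThresholdSubsetTriples DECIDES the summit by the proved
theorem `closes :
ThresholdSubsetTriples → VershikKerovBound → MatrixMultiplication` (CKSU2005 Cor. 1.9 = tree theorem
`CKSU2005_cor19_holds`;
VershikKerovBound PROVED), and the negative side ¬X = NoThresholdSubsetTriple with its global/junta
dichotomy is the route's own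
refutation programme. Mechanism: under the TPP the quotient sets A = S⁻¹T, B = T⁻¹U, C = U⁻¹S have
full size |S||T|, |T||U|, |U||S| and
exactly |S||T||U| = (|A||B||C|)^{1/2} solutions of abc = 1 (support QuotientSetDeficit, proved): at
the threshold these are three sets of
density e^{−O(√n)} whose product count is (n!)^{−1/2} times the mixing prediction — the most violent
failure of product mixing three
dense sets can show (d = 1 shadow: BlasiakCohnGrochowPrattUmans2023 Thm 3.2). Imported area:
analysis of Boolean functions on S_n
(EllisFriedgutPilpel2011; Filmus–Kindler–Lifshitz–Minzer arXiv:2009.05503; KeevashLifshitz2023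
level-d / hypercontractive inequalities
for global functions, product mixing Thm 1.14; Keevash–Lifshitz–Minzer arXiv:2205.15191; Eberhard
doi:10.19086/da.610): non-mixing forces
density bumps on umvirates, TPP is hereditary and right-translation invariant, so a compatible bump
triple descends to a TPP triple in
S_{n−t} with normalised volume multiplied by R_S·R_T·R_U/(n^{(t)})^{3/2} (support UmvirateDescent,
proved) — BCCGU17's proof of Thm 4.2 is
this descent for juntas; the NEUTRAL bump scale n^{t/2} per set is exactly where Young subgroups
with √n-blocks and the hyperoctahedral
groups B_m = S_2 ≀ S_m sit. REPAIR 2026-08-17 (revs 4–6, this planner): the first knife-edge pair is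
DECIDED. HyperoctahedralSubsets
(stmt-8305) is PROVED — `hyperoctahedralSubsets_proof` = 3-WISE GROUP PACKING
(`HyperoctahedralSubsets.card_mul_card_le_of_tpp_of_hosted`:
TPP subsets X_i of hosts C_i closed under a⁻¹b satisfy |X₀||X₁||X₂|·|T| ≤ |C₀||C₁||C₂| for every
group T of hosted product-one triples;
Cohn–Umans 2003 Lemma 3.1 is T = 1) fed by the MATCHING LEMMA (L′) `localTriplePacking_holds` (every
triple of perfect matchings of
[n] carries ≥ √n/4 commuting local product-one triples with pairwise disjoint supports, |T| ≥
2^{√n/4}) — and its push_neg twin, the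
former construction crux HyperoctahedralThreshold (stmt-10883), is REFUTED-substantive
(`not_HyperoctahedralThreshold`, p137218) and
DROPPED (rev 5; the pre-registered kill criterion). Two further negative tools landed with it: the
SUBGROUP-PIVOT SIEVE
(`HyperoctahedralThreshold.Negative.sieve`: a TPP triple whose first set is a whole subgroup H has
|H||X₁||X₂| ≤ |G|·d_max(G); with VK,
`conceded_subgroup_cap`: ≤ (n!)^{3/2}e^{−(c₂/2)√n} in S_n — every subgroup MEMBER and, by
translation, every conceded coset is fatal) and
the finite census of hosted capacity (crux NOTES §17: max TPP volume over subgroup triples in three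
matching centralisers = 32, 2048,
221 184, 56 623 104, ≥ 1.36·10^{10} at n = 4, 6, 8, 10, 12, i.e. fractions e^{−1.30}, e^{−2.24},
e^{−3.60}, e^{−4.80}, ≤ e^{−6.65} of
(n!)^{3/2}: an e^{−(0.5…0.7)n} decay, not e^{−c√n}). What the repair files: the NEXT RUNG
SubgroupHostedSubsets (no threshold design in ANY
three near-threshold subgroup hosts) with its proved edge SubgroupHostedEdge (¬SubgroupHostedSubsets
→ X): the same two-sided knife-edge
structure one level up — its proof extends BCCGU17 Thm 4.2 + HyperoctahedralSubsets to every
group-like host, its refutation is ω = 2.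

RANKED CRUXES. #0 ThresholdSubsetTriples (target) — X as in § Thesis; decides ω(ℂ) = 2 by `closes`;
staffed through its own crux lines
(Cruxes/ThresholdSubsetTriples: triality chain products; coset cap p117691 and full-block cap
p118696 landed). (why it might fail: ¬X may
simply be true — BCCGU17 Thm 4.2 kills Young triples, the sieve kills every triple with a subgroup
member, HyperoctahedralSubsets kills
the matching hosts, and all finite optima found (n ≤ 12) are thinned Young cosets decaying like
e^{−Θ(n)}.)
[BlasiakChurchCohnGrochowUmans2017, arXiv:1712.02302, BlasiakCohnGrochowPrattUmans2023,
CohnKleinbergSzegedyUmans2005, VershikKerov1985]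
#0 NoThresholdSubsetTriple (crux, rank 0: the NEGATIVE SIDE ¬X, kept by name since
DichotomyInduction targets it) — ∃ c > 0, n₀ such
that for n ≥ n₀ every TPP triple of subsets of S_n has |S||T||U| ≤ (n!)^{3/2} e^{−c√n}. (why it
might fail: one threshold family of
non-coset sets kills it; no tool reaches arbitrary sparse sets (μ = n!^{−1/2}).) [arXiv:1712.02302,
KeevashLifshitz2023]
#2 SubgroupHostedSubsets (crux, NEW 2026-08-17, co-rank 2: most informative next step, engines in
the tree) — NO SUBGROUP-HOSTED
THRESHOLD DESIGNS: ∃ c > 0, n₀: for n ≥ n₀, any subgroups H₀, H₁, H₂ ≤ S_n with |H₀||H₁||H₂| ≤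
(n!)^{3/2}e^{c√n} and any TPP subsets
X_i ⊆ H_i have |X₀||X₁||X₂| ≤ (n!)^{3/2}e^{−c√n}. Strictly between the proved HyperoctahedralSubsets
(hosts C(μ_i), |C|³ =
(n!)^{3/2}(πn/2)^{3/4}) and ¬X (NoThresholdSubsetTriple → SubgroupHostedSubsets, Sketch.lean);
cosets are covered by translation
invariance, conjugate hosts by quantifying over all subgroups. Intended proof: (1) STRUCTURE of
near-threshold subgroups (|H| ≥
√(n!)e^{−K√n}): orbits/blocks force H into products of wreath products S_a ≀ S_b with a ≤ 2 or few
big blocks (primitive constituents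
are tiny: |G| ≤ 4^d, PraegerSaxl1980/Maroti2002; S_a ≀ S_{n/a} for a ≥ 3 and Young groups with > √n
blocks are e^{−Θ(n)} below
threshold), up to index e^{O(√n)}; (2) per triple, either a PAIRWISE-FAT meet |H_i ∩ H_j| ≥ e^{3c√n}
(big symmetric factors on
overlapping supports; Young blocks of size ≈ e√n meet in ≥ 2 points, ∏ m_ij! = e^{Θ(n)}) — pairwise
packing — or ≥ 5c√n DISJOINT
COMMUTING PRODUCT-ONE GADGETS (matching-type factors: the matching lemma, to be extended to
involutions with O(√n) fixed points via its
avoid-set R, |R| ≤ n^{3/4}) — 3-wise packing; (3) possibly a ROBUST SIEVE for dense subsets of a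
subgroup (δ-dense X₀ ⊆ H ⇒
|H||X₁||X₂| ≤ δ^{−A}|G|d_max; A = 2 is trivial at H = G and the sieve at X₀ = H), which would prove
the crux with no classification at
all. [difficulty: XL] (why it might fail: see item.) [sources: see item]
#2 GlobalBranch (crux) — GLOBAL BRANCH at the corrected scale: ∃ ε, c > 0, n₀: for n ≥ n₀ every TPP
triple all of whose umvirate bumps up
to level √n are at most super-neutral (|X ∩ U_{I→L}|·n^{(t)} ≤ n^{(1/2+ε)t}|X|) has |S||T||U| ≤
(n!)^{3/2} e^{−c√n}. [difficulty:
open-problem] (why it might fail: no engine at this sparsity — KL23 Thm 1.9 needs log(1/μ) ≲ n but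
μ(S) = n!^{−1/2}; Kedlaya sets show
globalness alone cannot force bumps above n^{t/4}; an unrooted bump-neutral threshold triple refutes
it and proves X.)
[KeevashLifshitz2023, arXiv:2307.15030, arXiv:2205.15191, arXiv:2009.05503, doi:10.19086/da.610,
BlasiakCohnGrochowPrattUmans2023]
#3 JuntaBranch (crux) — JUNTA BRANCH (improvement form): for all ε, c > 0 there is n₀ such that
every TPP triple at scale c with a
super-neutral bump admits a TPP triple in some S_{n'}, n − √n ≤ n' < n, with normalised volume
multiplied by ≥ e^{c+1}. [difficulty: XL]
(refuter note g2: over-quantified — ∀c fails above the true decay constant while ¬X holds; the ∀ε ∃c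
re-quantification with matching
induction glue is TENURE work, not this repair.) (why it might fail: one bump must propagate to
compatible bumps of the other two sets
with gain > (n^{(t)})^{3/2}; B_m next to a random partial transversal propagates nothing.)
[arXiv:1712.02302, KeevashLifshitz2023,
arXiv:2205.15191, EllisFriedgutPilpel2011]
#4 HyperoctahedralSubsets (crux) — PROVED 2026-08-16 (`hyperoctahedralSubsets_proof`, stmt-8305
closed): the knife edge for the
matching hosts holds with saving 2^{√n/4}/(πn/2)^{3/4}. Kept as the route's first settled rung.
#5 PolynomialSlack (crux) — SUPER-POLYNOMIAL SAVING FOR ALL SUBSETS: for every C there is n₀ with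
|S||T||U|·n^C ≤ (n!)^{3/2} for all
TPP subset triples, n ≥ n₀. [difficulty: open-problem] (why it might fail: at polynomial density
KL23/KLM give only bounded-level bumps
n^{t/4}; a single poly-slack non-coset design refutes it.) [BlasiakCohnGrochowPrattUmans2023,
arXiv:2204.03826, KeevashLifshitz2023]
#9 SubgroupHostedEdge (support, NEW, provable now — proved in Sketch.lean, 6 lines: forget the
hosts) — ¬SubgroupHostedSubsets →
ThresholdSubsetTriples: the new crux's edge to `closes` (refuting it gives ω(ℂ) = 2), the analogue
of NegativeSideResistance.
#9 QuotientSetDeficit, UmvirateDescent, DichotomyInduction (GlobalBranch → JuntaBranch →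
NoThresholdSubsetTriple), VershikKerovBound,
NoThresholdIffNotThreshold, NegativeSideResistance ((¬GlobalBranch ∨ ¬HyperoctahedralSubsets ∨
¬PolynomialSlack ∨
¬NoThresholdSubsetTriple) → X), Assembly (= the type of `closes`) — all PROVED (supports, closed).
RECORDS (inactive): HyperoctahedralThreshold (stmt-10883, ex-#2) REFUTED by
`not_HyperoctahedralThreshold` @ c8e3065af9bd and dropped
rev 5; HyperoctahedralToThreshold (stmt-10884, ex-support, proved) dropped rev 6 — its statement
names the dropped constant and its
content is the proved `NegativeSideResistance` edge
`thresholdSubsetTriples_of_not_hyperoctahedralSubsets`.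
PROVER NOTE (dependency drift caused by the rev-5 drop; for the migrate/fix seat): from rev 5 the
gate no longer renders the constants
`Summit.MatrixMultiplication.MatrixMultiplication.Theses.SnSubsetDichotomy.HyperoctahedralThreshold`
and `….HyperoctahedralToThreshold`,
but four Theorems files name them: (d)
HyperoctahedralThreshold/Negative/HyperoctahedralThresholdFalseOfLocalTriplePacking.lean (last
theorem `hyperoctahedralThreshold_false_of_localTriplePacking`; IMPORTED by
SnSubsetDichotomyHyperoctahedralSubsets.lean = the proof of
8305 and by (b)), (b) SnSubsetDichotomyHyperoctahedralThresholdRefutation.lean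
(`not_HyperoctahedralThreshold`), (a)
SnSubsetDichotomyNegativeSideResistance.lean (lines 62–81: Edge 2 of `negativeSideResistance_proof`
is routed through the constant, so
the whole file breaks with it), (c) SnSubsetDichotomyHyperoctahedralToThreshold.lean (orphan now).
Minimal patch, as done for LevelGradedCohnUmans rev 3 /
DesignFlattening rev 5 / ThinBlockAlpha rev 6: re-declare VERBATIM, inside `namespace
Summit.MatrixMultiplication.MatrixMultiplication.Theses.SnSubsetDichotomy`, `def
HyperoctahedralThreshold : Prop := ∀ c : ℝ, 0 < c → ∀
n₀ : ℕ, ∃ n ≥ n₀, ∃ μ : Fin 3 → Equiv.Perm (Fin n), (∀ i, μ i * μ i = 1 ∧ ∀ x, μ i x ≠ x) ∧ ∃ X :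
Fin 3 → Finset (Equiv.Perm (Fin
n)), (∀ i, ∀ σ ∈ X i, σ * μ i = μ i * σ) ∧ Literature.Combinatorics.Additive.TripleProductProperty
(X 0) (X 1) (X 2) ∧ (n.factorial :
ℝ) ^ ((3 : ℝ) / 2) * Real.exp (-(c * Real.sqrt (n : ℝ))) < (((X 0).card * (X 1).card * (X 2).card :
ℕ) : ℝ)` (and, only where (c) is
kept, `def HyperoctahedralToThreshold : Prop := HyperoctahedralThreshold → ThresholdSubsetTriples`)
in ONE small module imported by
(a), (c), (d) — or at the top of (d) with (a), (c) importing (d) — never twice along one import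
chain.

KILL CRITERIA. Exactly one side dies. NoThresholdSubsetTriple (¬X) PROVED — directly, via
GlobalBranch ∧ JuntaBranch and
DichotomyInduction, via SubgroupHostedSubsets plus a structure theorem forcing threshold designs
into near-threshold subgroup hosts, or
elsewhere via a slice-rank bound n!/e^{Ω(√n)} for S_n — ⇒ the target is refuted
(NoThresholdIffNotThreshold), the gate breaks the
route and it is closed `refuted:ThresholdSubsetTriples`: BCCGU17 §4's subsets question settled — the
informative failure.
SubgroupHostedSubsets PROVED ⇒ every group-like host is dead; the constructive side is confined to
genuinely non-coset sets (the
target lead's chain products / entropy-exact designs); if PolynomialSlack is proved as well, the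
tenure planner concedes the deciding
side (close `refuted` once ¬X lands, or `exhausted` with the census). SubgroupHostedSubsets REFUTED
⇒ the witness family PROVES the
target through SubgroupHostedEdge and `closes` fires: ω(ℂ) = 2 (hand the family to
GroupTheoreticSTPP). ThresholdSubsetTriples PROVED
directly ⇒ the same. GlobalBranch refuted ALONE by a bump-neutral threshold triple ⇒ that witness
PROVES the target. JuntaBranch
refuted without a threshold witness ⇒ restate it (∀ε ∃c, refuter note) or drop the dichotomy. (Fired
2026-08-17: HyperoctahedralSubsets
PROVED ⇒ HyperoctahedralThreshold refuted ⇒ dropped, next rung filed — this revision.)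

NOT DECOMPOSED YET. Children of SubgroupHostedSubsets (filed only once it is staffed and a lead
asks): NearThresholdStructure (the
classification step (1)), PairwiseOrGadgets (step (2)), FixedPointMatchingLemma ((L′) for
involutions with ≤ K√n fixed points, avoid-set
form), RobustSieve (step (3)); the STRONGER window ∀C ∃c (hosts up to e^{C√n} above threshold —
believed true, not reachable by a
2^{√n/4} saving once C > (ln 2)/12, so deliberately not the filed form); the constructive negation
¬SubgroupHostedSubsets as its own
item (it is served implicitly: any refuter of the crux proves X); the card's G^m thesis T3
(SL_2(q)^m; product-space hypercontractivity
arXiv:1906.05568) — a separate thesis; the A_n variant; the level-t inequality for sparse sets and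
the quotient-structure lemma
(children of GlobalBranch); BumpPropagation (child of JuntaBranch); the re-quantified JuntaBranch
(∀ε ∃c; tenure); vendoring
KeevashLifshitz2023 Thms 1.8/1.9/1.14 as Literature facts (cite item, only on a prover's request).

CHEAPEST FALSIFIER. For the new rung: (i) extend the c5 census engine (all subgroups of the hosts,
exact TPP over subgroup triples,
`Cruxes/HyperoctahedralThreshold` §17.2: gensubs.py / hosts.py / tppsub2.c) from three matching
centralisers to the other
near-threshold host classes at n = 8, 10, 12 — C(μ) for involutions with 2 fixed points, S_2 ×
B_{(n−2)/2}, S_3 × B, Young S_λ with two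
or three blocks, index-2 subgroups of S_{n/2} ≀ S_2 — and compare log(V_max/(n!)^{3/2}) with the
matching-host column (−3.60, −4.80,
≤ −6.65): a class decaying markedly SLOWER than the matching hosts is where a refuter of
SubgroupHostedSubsets (= a prover of X) should
dig, uniform e^{−Θ(n)} decay supports the crux; (ii) the robust-sieve inequality |H||X₁||X₂| ≤
(|H|/|X₀|)²·|G|·d_max tested exactly at
n = 6, 8 on dense subsets X₀ of B_m and of S_λ against free X₁, X₂ (max-clique engine of the ccert
seat): one violation kills engine (3),
none found makes it the first stub to prove. For the route as a whole the only killer of the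
deciding side remains a PROOF of ¬X.

NUMBERS. Threshold calibration (BCCGU17 §5): sets of size n!^{1/2}/e^{O(√n)} must be ruled out,
n!^{1/2}/e^{o(√n)} proves ω = 2;
d_max(S_n) = √(n!)e^{−Θ(√n)} (VershikKerov1985; tree: c₁ = π/√6 lower, c₂ = (π−2)/π² ≈ 0.1157 upper,
PROVED); kill-link arithmetic:
|S||T||U| ≥ (n!)^{3/2}e^{−c√n} with d_max ≤ √(n!)e^{−c₁√n} certifies ω ≤ 2/(1 − c/(3c₁)).
Near-threshold hosts (log-orders against ½ log n!):
B_m = S_2 ≀ S_m: +¼ log(πn/2); C(μ) with k fixed points: ≈ k(log(4k²/n) − 2) (below B_m for k <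
1.36√n, e^{C√n} above needs a free
symmetric factor S_{K√n}, K(log K − 1) = C); Young S_λ with equal blocks b: n log b − n vs ½ n log n
− ½ n ⇒ b ≈ √(e n), tunable to any
target within a factor √n; S_a ≀ S_{n/a}, a ≥ 3: (n/a) log n ≪ ½ n log n (far below); primitive
non-giant: ≤ 4^n (PraegerSaxl1980,
Maroti2002). Savings in hand: matching hosts 2^{√n/4} = e^{0.173√n} (3-wise packing at (L′), c =
1/4); subgroup member or conceded coset:
e^{(c₂/2)√n} (sieve + VK); two Young hosts with blocks ≈ e√n: pairwise meet ∏ m_ij! = e^{Θ(n)}.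
Census (hosted capacity, matching hosts,
max over subgroup triples): n = 4: 32; 6: 2048; 8: 221 184 (26/26 host classes); 10: 56 623 104
(118/118); 12: ≥ 13 589 544 960 (partial)
— ratios to (n!)^{3/2}: e^{−1.30}, e^{−2.24}, e^{−3.60}, e^{−4.80}, ≤ e^{−6.65}. Target-side census
(Cruxes/ThresholdSubsetTriples c4): best
symmetric chain products equal the best subgroup designs exactly (12, 144, 1728 at n = 6, 9, 12),
all thinned Young cosets. Descent
bookkeeping and the limits (O1)/(O2) of KeevashLifshitz2023 Thms 1.9/1.14 as recorded at rev 1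
(unchanged). Items after this repair: 14
active (target, 6 cruxes of which HyperoctahedralSubsets is proved, 7 supports incl. Assembly, all
supports proved except the new
SubgroupHostedEdge) + 2 inactive records.

DEFINITION REQUESTS. None: hosts are `Subgroup (Equiv.Perm (Fin n))` with `Nat.card`, hosted sets `∀
i, ∀ σ ∈ X i, σ ∈ H i`,
umvirates inline as `X.filter (fun σ => ∀ k, σ (I k) = L k)`, n^{(t)} = `Nat.descFactorial n t`, TPP
= the tree's
`Literature.Combinatorics.Additive.TripleProductProperty`, matchings = fixed-point-free involutions.

Novelty: Searches (2026-08-15): `lit search "hypercontractivity symmetric group global functions product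
mixing"` (5 local: arXiv:2307.15030,
2205.15191, 2009.05503, 2401.15456, 2404.00641; zbMATH 2: arXiv:2308.08694 Lifshitz–Marmor, FOCS'22
proc.; OpenAlex/S2/arXiv HTTP 429);
`lit search --source zbmath "triple product property symmetric group"` (10, none relevant); `lit
search --source zbmath "Kedlaya product-free
permutations umvirate"` (0); `lit search --source local "umvirate global product mixing triple
product"` (1: 2307.15030 p. 6);
`lit galaxy search "triple product property subsets symmetric group matrix multiplication" --star
all` (0); `lit galaxy search "product-free
subsets of the alternating group" --star all` (1: arXiv:2209.04243 Ellis–Kindler–Lifshitz, Bonami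
lemma on L(V,W)); held texts READ this
session: arXiv:2307.15030 §1 (Thms 1.1–1.15, Defs 1.6, 1.13), §2.1 (Lemmas 1.1–1.2, proof of Thm
1.2), §7 (sharpness example, Lemmas
7.2–7.3, product-mixing computation); arXiv:1712.02302 §4 pp. 9–10 (Thm 4.2, open question "all
triples of subgroups … or even all
triples of subsets"), §5 p. 11 (threshold n!^{1/2}/e^{O(√n)} vs e^{o(√n)}); tree files
QuasirandomBarrier, YoungSubgroupBarrier,
CohnUmansTPP, TripleProductProperty, SnThresholdCensus.lean, GroupTheoreticSTPP.lean; the card's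
refuter audit (same ids).
Nearest prior art found: BlasiakCohnGrochowPrattUmans2023 (arXiv:2204.03826) Thm 3.2 — the d = 1
(quasirandom) instance of
GlobalBranch, saving √(n−1) in S_n; BlasiakCh  [refs: 2307.15030, 2308.08694, 2209.04243, 1712.02302, 2204.03826, 2205.15191, BlasiakCohnGrochowPrattUmans2023, BlasiakChurchCohnGrochowUmans2017, KeevashLifshitz2023]

Barriers (technique_class: group-theoretic-approach, TPP-subsets-Sn, hypercontractivity): - technique_class: group-theoretic-approach, TPP-subsets-Sn, hypercontractivity
- Literature.Barriers.MatrixMultiplication.YoungSubgroupBarrier: the DECIDING side evades it by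
leaving its class — `BCCGU2017_thm42` kills threshold triples of three YOUNG subgroups (peel a
part), while the target and HyperoctahedralThreshold ask for SUBSETS of the non-Young,
self-normalising hosts B(M_i) = S_2 ≀ S_{n/2} (|B_m| = √(n!)(πn/2)^{1/4}, above threshold); the kill
link in its evasions_known clause (sets ≥ √(n!)/e^{o(√n)} prove ω = 2) is now the PROVED deciding
theorem `closes`. The negative side generalises it: JuntaBranch + UmvirateDescent is its proof for
juntas, and ¬X = NoThresholdSubsetTriple is its open extension to all subsets — proving it refutes
this route.
- Literature.Barriers.MatrixMultiplication.QuasirandomBarrier: does not bite on the deciding side —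
`BCGPU2023_thm32` saves only √(n(S_n)) = √(n−1) for arbitrary subsets, a polynomial factor inside
the e^{o(√n)} slack the target allows; on the negative side it is the level-1 case of GlobalBranch,
and (O2) records that globalness alone cannot deliver the level-t refinement.
- Literature.Barriers.MatrixMultiplication.NormalizerBarrier: subgroup hosts only
(`SubgroupTPP.normalizer_barrier`, proved); void for subsets and on the self-normalising B(M) — the
reason the construction crux lives in B(M_i) and HyperoctahedralSubsets is its own crux.
- Literature.Barriers.MatrixMultiplication.NilpotentGroupBarrier: n/a — one S_n per n,

Novelty grade: new-combination — new-combination (refuter rreview g2). Ingredient 1: BCCGU17 arXiv:1712.02302 Thm 4.2 (Young case by peeling a part = JuntaBranch+UmvirateDescent for juntas) and its Sec.5-6 subsets question with the e^{O(sqrt n)}/e^{o(sqrt n)} calibration (= X + kill link); BCGPU23 arXiv:2204.03826 Thm 3.2 = level-1 (refuter refuter-rreview-route-MatrixMultiplicati-549f6854-g2-0, 2026-08-15T14:35:00Z; prior: arXiv:1712.02302,arXiv:2204.03826,arXiv:2307.15030,arXiv:2205.15191,arXiv:2009.05503,EllisFriedgutPilpel2011)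

History (route lifecycle, newest last):
- 2026-08-15T16:27:55Z · rev 1: restated Assembly (stmt-MatrixMultiplication-8310) — D-0027 §2.1 route repair (rbadge g2): deciding side becomes the target — +ThresholdSubsetTriples (target), +HyperoctahedralThreshold (crux 2), +HyperoctahedralT (planner-rbadge-MatrixMultiplication-SnSubsetDi-6cc494d4-g2-0)
- 2026-08-17T01:56:36Z · BROKEN — HyperoctahedralThreshold (stmt-MatrixMultiplication-10883, crux) refuted by Summit.MatrixMultiplication.MatrixMultiplication.Theorems.not_HyperoctahedralThreshold @ c8e3065af9bd (prover-line-stmt-MatrixMultiplication-10883-c5-0)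
- 2026-08-17T02:16:07Z · rev 5: dropped HyperoctahedralThreshold — repair step 2 (route-repair unit): drop the refuted construction crux HyperoctahedralThreshold (stmt-10883, refuted-substantive by not_HyperoctahedralThreshold (planner-rfix-MatrixMultiplication-SnSubsetDi-6cc494d4-0)
- 2026-08-17T02:16:07Z · REPAIRED (drop HyperoctahedralThreshold) — back to open: repair step 2 (route-repair unit): drop the refuted construction crux HyperoctahedralThreshold (stmt-10883, refuted-substantive by not_HyperoctahedralThreshold (planner-rfix-MatrixMultiplication-SnSubsetDi-6cc494d4-0)
- 2026-08-17T02:27:44Z · rev 6: dropped HyperoctahedralToThreshold — repair step 3a (route-repair unit): drop the ex-support HyperoctahedralToThreshold (stmt-10884, proved): its statement HyperoctahedralThreshold → ThresholdSubse (planner-rfix-MatrixMultiplication-SnSubsetDi-6cc494d4-0)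

sub-problem: MatrixMultiplication · status: open · opened planner-plancard-MatrixMultiplication-MatrixM-c94acfcb-0 2026-08-15T12:37:55Z · rev 7 · ledger route-MatrixMultiplication-SnSubsetDichotomy
GENERATED by the gate from the ledger (D-0016/17). Provers cite these decls: `theorem foo : Summit.MatrixMultiplication.MatrixMultiplication.Theses.SnSubsetDichotomy.<Decl> := …` in Summits/MatrixMultiplication/MatrixMultiplication/Theorems/<Name>.lean.
-/

namespace Summit.MatrixMultiplication.MatrixMultiplication.Theses.SnSubsetDichotomy

open scoped BigOperators Topology Manifold Classical MeasureTheory ProbabilityTheory Matrix InnerProductSpace ComplexConjugate ContinuousMap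
open Filter Set Function TopologicalSpace MeasureTheory

attribute [summit_statement] _root_.MatrixMultiplication

/-- item stmt-MatrixMultiplication-10882 · crux (kind.auto-crux: conjecture-grade) · rank 0 · open · by planner
why it might fail: ¬X = NoThresholdSubsetTriple may simply be true: BCCGU17 Thm 4.2 kills all Young triples, BCGPU23 Thm 3.2 saves √(n−1) for all subsets, no threshold family is known in any group, and this route's own global/junta dichotomy is built to prove ¬X.
sources: BlasiakChurchCohnGrochowUmans2017, arXiv:1712.02302, BlasiakCohnGrochowPrattUmans2023, CohnKleinbergSzegedyUmans2005, VershikKerov1985, lean:Literature.Computability.AlgebraicComplexity.CKSU2005_cor19_holds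
[target] X (D-0027 §2.1 route repair 2026-08-15: the DECIDING side of the subsets dichotomy becomes
the target): for every c > 0 and n₀ some n ≥ n₀ and a TPP triple of subsets S, T, U ⊆ S_n with
|S||T||U| > (n!)^{3/2}·e^{−c√n} — threshold TPP subset triples (slack e^{−o(√n)} below the packing
bound); the positive form of ¬NoThresholdSubsetTriple (support NoThresholdIffNotThreshold). Decides
the summit: closes : ThresholdSubsetTriples → VershikKerovBound → MatrixMultiplication (CKSU Cor.
1.9 = tree theorem CKSU2005_cor19_holds; proved sorry-free in the repair planner's Sketch.lean).
[difficulty: open-problem] -/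
@[route_item "route-MatrixMultiplication-SnSubsetDichotomy", crux]
def ThresholdSubsetTriples : Prop :=
  ∀ c : ℝ, 0 < c → ∀ n₀ : ℕ, ∃ n ≥ n₀, ∃ S T U : Finset (Equiv.Perm (Fin n)), Literature.Combinatorics.Additive.TripleProductProperty S T U ∧ (n.factorial : ℝ) ^ ((3 : ℝ) / 2) * Real.exp (-(c * Real.sqrt (n : ℝ))) < ((S.card * T.card * U.card : ℕ) : ℝ)

/-- item stmt-MatrixMultiplication-8302 · crux · rank 0 · open · by planner
why it might fail: The hyperoctahedral knife edge: rooted matching stabilisers B(M_a) ∩ Stab(0) are pairwise trivial at slack n³ and no tool for non-Young subsets of S_n exists (BCCGU17 §4–5); one threshold family (HyperoctahedralThreshold) kills it — and proves ω = 2 via closes.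
sources: BlasiakChurchCohnGrochowUmans2017, arXiv:1712.02302, BlasiakCohnGrochowPrattUmans2023, KeevashLifshitz2023, lean:Literature.Barriers.MatrixMultiplication.BCCGU2017_thm42
[target] X as in § Thesis: ∃ c > 0, n₀ such that for n ≥ n₀ every TPP triple of subsets S, T, U of
S_n has |S||T||U| ≤ (n!)^{3/2} e^{−c√n} (card items N2/T2; implies route SnThresholdCensus's
NoThresholdSubgroupTriple). -/
@[route_item "route-MatrixMultiplication-SnSubsetDichotomy"]
def NoThresholdSubsetTriple : Prop :=
  ∃ c : ℝ, 0 < c ∧ ∃ n₀ : ℕ, ∀ n ≥ n₀, ∀ S T U : Finset (Equiv.Perm (Fin n)), Literature.Combinatorics.Additive.TripleProductProperty S T U → ((S.card * T.card * U.card : ℕ) : ℝ) ≤ (n.factorial : ℝ) ^ ((3 : ℝ) / 2) * Real.exp (-(c * Real.sqrt (n : ℝ)))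

/-- item stmt-MatrixMultiplication-18339 · crux · rank 2 · open · by planner
why it might fail: Near-threshold subgroups of S_n are a zoo (index-e^{O(√n)} subgroups of S_k×S_{n−k}, of S_{n/2}≀S_2, C(μ) with O(√n) fixed points, S_k×B_m); a triple with pairwise meets e^{o(√n)} and o(√n) disjoint commuting product-one gadgets defeats both packings — and a hosted design there is ω = 2.
sources: BlasiakChurchCohnGrochowUmans2017, arXiv:1712.02302, CohnUmans2003, PraegerSaxl1980, Maroti2002, DixonMortimer1996
[crux] NO SUBGROUP-HOSTED THRESHOLD DESIGNS (next rung after the decided knife-edge pair, 2026-08-17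
repair): ∃ c > 0, n₀ such that for n ≥ n₀, any three subgroups H₀, H₁, H₂ ≤ S_n with |H₀||H₁||H₂| ≤
(n!)^{3/2}e^{c√n} and any TPP subsets X_i ⊆ H_i have |X₀||X₁||X₂| ≤ (n!)^{3/2}e^{−c√n}. Implied by
NoThresholdSubsetTriple (Sketch.lean), implies for large n the proved HyperoctahedralSubsets
(|C(μ)|³ = (n!)^{3/2}(πn/2)^{3/4}); cosets are covered by right-translation invariance, conjugate
hosts by quantifying over all subgroups. Engines: (1) structure of near-threshold subgroups |H| ≥
√(n!)e^{−K√n} (orbits/blocks ⇒ products of wreath pieces S_a ≀ S_b with a ≤ 2 or few big blocks, up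
to index e^{O(√n)}; primitive non-giant pieces ≤ 4^d, PraegerSaxl1980/Maroti2002); (2) per triple
either a pairwise-fat meet |H_i ∩ H_j| ≥ e^{3c√n} (pairwise packing, Cohn–Umans 2003 Lemma 3.1) or ≥
5c√n disjoint commuting product-one gadgets (3-wise group packing
`HyperoctahedralSubsets.card_mul_card_le_of_tpp_of_hosted` + the matching lemma
`localTriplePacking_holds`, to be extended to involutions with O(√n) fixed points through its
avoid-set R, |R| ≤ n^{3/4}); (3) optionally a robust subgroup-pivot siev -/
@[route_item "route-MatrixMultiplication-SnSubsetDichotomy"]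
def SubgroupHostedSubsets : Prop :=
  ∃ c : ℝ, 0 < c ∧ ∃ n₀ : ℕ, ∀ n ≥ n₀, ∀ H : Fin 3 → Subgroup (Equiv.Perm (Fin n)), (Nat.card (H 0) : ℝ) * (Nat.card (H 1) : ℝ) * (Nat.card (H 2) : ℝ) ≤ (n.factorial : ℝ) ^ ((3 : ℝ) / 2) * Real.exp (c * Real.sqrt (n : ℝ)) → ∀ X : Fin 3 → Finset (Equiv.Perm (Fin n)), (∀ i, ∀ σ ∈ X i, σ ∈ H i) → Literature.Combinatorics.Additive.TripleProductProperty (X 0) (X 1) (X 2) → (((X 0).card * (X 1).card * (X 2).card : ℕ) : ℝ) ≤ (n.factorial : ℝ) ^ ((3 : ℝ) / 2) * Real.exp (-(c * Real.sqrt (n : ℝ)))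

/-- item stmt-MatrixMultiplication-8303 · crux · rank 2 · open · by planner
why it might fail: No engine at this sparsity: KL23 Thm 1.9 needs log(1/μ) ≲ n but μ(S) = n!^{-1/2}; on the dense quotient sets, Kedlaya sets K_{x,I} (|I| ~ n^{3/4}) are product-free at density e^{-K√n} with bumps ≤ n^{1/4}; an unrooted bump-neutral TPP triple inside three B(M_i) at poly slack refutes it.
sources: KeevashLifshitz2023, arXiv:2307.15030, arXiv:2205.15191, arXiv:2009.05503, doi:10.19086/da.610, BlasiakCohnGrochowPrattUmans2023
[crux] GLOBAL BRANCH (card branch (G) at the corrected scale): there are ε, c > 0, n₀ such that for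
n ≥ n₀ every TPP triple (S,T,U) in S_n all of whose umvirate bumps up to level √n are at most
super-neutral — |X ∩ U_{I→L}|·n^{(t)} ≤ n^{(1/2+ε)t}|X| for X ∈ {S,T,U}, 1 ≤ t ≤ √n, I, L injective
t-tuples — has |S||T||U| ≤ (n!)^{3/2} e^{−c√n}. Contains the full-hyperoctahedral and √n-block Young
configurations (bump-neutral). [difficulty: open-problem] -/
@[route_item "route-MatrixMultiplication-SnSubsetDichotomy"]
def GlobalBranch : Prop :=
  ∃ ε : ℝ, 0 < ε ∧ ∃ c : ℝ, 0 < c ∧ ∃ n₀ : ℕ, ∀ n ≥ n₀, ∀ S T U : Finset (Equiv.Perm (Fin n)), Literature.Combinatorics.Additive.TripleProductProperty S T U → (∀ X : Finset (Equiv.Perm (Fin n)), (X = S ∨ X = T ∨ X = U) → ∀ t : ℕ, 1 ≤ t → (t : ℝ) ≤ Real.sqrt (n : ℝ) → ∀ I L : Fin t → Fin n, Function.Injective I → Function.Injective L → ((X.filter (fun σ => ∀ k, σ (I k) = L k)).card : ℝ) * (n.descFactorial t : ℝ) ≤ (n : ℝ) ^ ((1 / 2 + ε) * t) * (X.card : ℝ))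 → ((S.card * T.card * U.card : ℕ) : ℝ) ≤ (n.factorial : ℝ) ^ ((3 : ℝ) / 2) * Real.exp (-(c * Real.sqrt (n : ℝ)))

/-- item stmt-MatrixMultiplication-8304 · crux · rank 3 · open · by planner
why it might fail: One bump must propagate to compatible bumps of the other two sets with gain > (n^{(t)})^{3/2}; B_m next to a random partial transversal shows pairwise unique products propagate nothing, and for rooted AP-matching triples every compatible restriction after step one loses ≈ n^{-3}.
sources: BlasiakChurchCohnGrochowUmans2017, arXiv:1712.02302, KeevashLifshitz2023, arXiv:2205.15191, EllisFriedgutPilpel2011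
[crux] JUNTA BRANCH (card branch (J), improvement form): for all ε, c > 0 there is n₀ such that for
n ≥ n₀, every TPP triple in S_n with |S||T||U| ≥ (n!)^{3/2}e^{−c√n} in which some X ∈ {S,T,U} has a
super-neutral bump (> n^{(1/2+ε)t} at some level 1 ≤ t ≤ √n) admits a TPP triple in some S_{n'}, n −
√n ≤ n' < n, with normalised volume |S'||T'||U'|/(n'!)^{3/2} ≥ e^{c+1}·|S||T||U|/(n!)^{3/2}.
Intended move: propagate the bump through A = S⁻¹T to compatible bumps (common target L,
Cauchy–Schwarz on the laws of t∘I, s∘J) and restrict (UmvirateDescent). [difficulty: XL] -/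
@[route_item "route-MatrixMultiplication-SnSubsetDichotomy"]
def JuntaBranch : Prop :=
  ∀ ε : ℝ, 0 < ε → ∀ c : ℝ, 0 < c → ∃ n₀ : ℕ, ∀ n ≥ n₀, ∀ S T U : Finset (Equiv.Perm (Fin n)), Literature.Combinatorics.Additive.TripleProductProperty S T U → (n.factorial : ℝ) ^ ((3 : ℝ) / 2) * Real.exp (-(c * Real.sqrt (n : ℝ))) ≤ ((S.card * T.card * U.card : ℕ) : ℝ) → (∃ X : Finset (Equiv.Perm (Fin n)), (X = S ∨ X = T ∨ X = U) ∧ ∃ t : ℕ, 1 ≤ t ∧ (t : ℝ) ≤ Real.sqrt (n : ℝ) ∧ ∃ I L : Fin t → Fin n, Function.Injective I ∧ Function.Injective L ∧ (n : ℝ) ^ ((1 / 2 + ε) * t) * (X.card : ℝ) < ((X.filter (fun σ => ∀ k, σ (I k) = L k)).card : ℝ) * (n.descFactorial t : ℝ)) → ∃ n' : ℕ, (n : ℝ) - Real.sqrt (n : ℝ) ≤ (n' : ℝ) ∧ n' < n ∧ ∃ S' T' U' : Finset (Equiv.Perm (Fin n')), Literature.Combinatorics.Additive.TripleProductProperty S'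 T' U' ∧ Real.exp (c + 1) * ((S.card * T.card * U.card : ℕ) : ℝ) * ((n'.factorial : ℝ) / (n.factorial : ℝ)) ^ ((3 : ℝ) / 2) ≤ ((S'.card * T'.card * U'.card : ℕ) : ℝ)

/-- item stmt-MatrixMultiplication-8305 · crux · rank 4 · closed · proved by Summit.MatrixMultiplication.MatrixMultiplication.Theorems.hyperoctahedralSubsets_proof @ 956e0290ee98 (prover) · by planner
why it might fail: Rooted stabilisers B(M_a) ∩ Stab(0), M_a = {x, a−x} on ℤ/2m (a = 1,3,5), are pairwise trivial at |X₁||X₂||X₃| = (n!)^{3/2}(πn/2)^{3/4}n^{-3}; only the genuine triple condition separates, and a TPP sub-triple of index poly(n) refutes the crux and gives ω = 2.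
sources: BlasiakChurchCohnGrochowUmans2017, arXiv:1712.02302, Macdonald1995, JamesKerber1981, arXiv:1906.05568, lean:Literature.Barriers.MatrixMultiplication.SubgroupTPP.normalizer_barrier
[crux] THE KNIFE EDGE FOR SUBSETS (where both branches are neutral): ∃ c > 0, n₀: for n ≥ n₀, any
three fixed-point-free involutions μ_i (perfect matchings M_i) and subsets X_i ⊆ C(μ_i) = B(M_i) ≅
S_2 ≀ S_{n/2} with the TPP have |X₁||X₂||X₃| ≤ (n!)^{3/2} e^{−c√n}. Since |B_m| = √(n!)(πn/2)^{1/4},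
this is a polynomial-slack statement; it implies SnThresholdCensus's HyperoctahedralTriples
(subgroups K_i ≤ B(M_i)). Natural engine: harmonic analysis on B_m ⊃ (ℤ/2)^m (product-space global
hypercontractivity, Keevash–Lifshitz–Long–Minzer (arXiv:1906.05568)) and the Gelfand pair (S_{2m},
B_m). [difficulty: open-problem] -/
@[route_item "route-MatrixMultiplication-SnSubsetDichotomy"]
def HyperoctahedralSubsets : Prop :=
  ∃ c : ℝ, 0 < c ∧ ∃ n₀ : ℕ, ∀ n ≥ n₀, ∀ μ : Fin 3 → Equiv.Perm (Fin n), (∀ i, μ i * μ i = 1 ∧ ∀ x, μ i x ≠ x) → ∀ X : Fin 3 → Finset (Equiv.Perm (Fin n)), (∀ i, ∀ σ ∈ X i, σ * μ i = μ i * σ) → Literature.Combinatorics.Additive.TripleProductProperty (X 0) (X 1) (X 2) → (((X 0).card * (X 1).card * (X 2).card : ℕ) : ℝ) ≤ (n.factorial : ℝ) ^ ((3 : ℝ) / 2) * Real.exp (-(c * Real.sqrt (n : ℝ)))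

/-- item stmt-MatrixMultiplication-8306 · crux · rank 5 · open · by planner
why it might fail: At polynomial density KL23 Thm 1.14 / KLM stability give only bounded-level bumps of size n^{t/4} on the quotient sets, below the neutral n^{t/2}; and a single TPP triple among poly-index subsets of three B(M_i) (searchable at n = 8–12) refutes it.
sources: BlasiakCohnGrochowPrattUmans2023, arXiv:2204.03826, KeevashLifshitz2023, arXiv:2205.15191, BlasiakChurchCohnGrochowUmans2017, lean:Literature.Barriers.MatrixMultiplication.BCGPU2023_thm32
[crux] SUPER-POLYNOMIAL SAVING FOR ALL SUBSETS (card N1/T1, the first milestone below X): for every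
C there is n₀ with |S||T||U|·n^C ≤ (n!)^{3/2} for all TPP triples of subsets of S_n, n ≥ n₀. Kills
every polynomial-slack design (in particular the sibling card hyperoctahedral-matching-tpp); weaker
than X, stronger than BCGPU's |S||T||U| ≤ (n!)^{3/2}/√(n−1) + n!. [difficulty: open-problem] -/
@[route_item "route-MatrixMultiplication-SnSubsetDichotomy"]
def PolynomialSlack : Prop :=
  ∀ C : ℝ, ∃ n₀ : ℕ, ∀ n ≥ n₀, ∀ S T U : Finset (Equiv.Perm (Fin n)), Literature.Combinatorics.Additive.TripleProductProperty S T U → ((S.card * T.card * U.card : ℕ) : ℝ) * (n : ℝ) ^ C ≤ (n.factorial : ℝ) ^ ((3 : ℝ) / 2)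

/-- item stmt-MatrixMultiplication-10885 · support · rank 9 · closed · proved by Summit.MatrixMultiplication.MatrixMultiplication.Theorems.noThresholdIffNotThreshold_proof @ 3594da211c98 (prover) · by planner
sources: BlasiakChurchCohnGrochowUmans2017
[support] bookkeeping, provable now (pure logic: push_neg + rfl; repair planner's Sketch.lean): the
negative side NoThresholdSubsetTriple is exactly the refutation of the target ThresholdSubsetTriples
— the route is decided by exactly one of them; a proof of NoThresholdSubsetTriple is a one-line
refutation of the target. [difficulty: provable-now] -/
@[route_item "route-MatrixMultiplication-SnSubsetDichotomy"]
def NoThresholdIffNotThreshold : Prop :=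
  NoThresholdSubsetTriple ↔ ¬ ThresholdSubsetTriples

/-- item stmt-MatrixMultiplication-14825 · support · rank 9 · closed · proved by Summit.MatrixMultiplication.MatrixMultiplication.Theorems.negativeSideResistance_proof (prover) · by planner
sources: BlasiakChurchCohnGrochowUmans2017, arXiv:1712.02302, CohnKleinbergSzegedyUmans2005
[support] RESISTANCE OF THE NEGATIVE SIDE (route-repair 2026-08-16, glue for the unused-crux audit):
the negative-side cruxes NoThresholdSubsetTriple (= ¬target, NoThresholdIffNotThreshold),
GlobalBranch, HyperoctahedralSubsets (= ¬HyperoctahedralThreshold by push_neg) and PolynomialSlack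
are each COROLLARIES of ¬target, so no implication `Crux → closes-hypothesis` can hold; their honest
edge to the deciding theorem is the negative one — REFUTING any one of them yields threshold TPP
subset triples, i.e. the target ThresholdSubsetTriples, and `closes` fires (ω(ℂ) = 2).
¬GlobalBranch: bump-neutral threshold triples exist infinitely often (take ε := 1 and forget
bump-freeness; = the standing disprover's `resistance`, Cruxes/GlobalBranch/Disproof.lean §1).
¬HyperoctahedralSubsets: literally HyperoctahedralThreshold, then forget the hosts
(HyperoctahedralToThreshold). ¬PolynomialSlack: one C and infinitely many TPP triples with |S||T||U|
> (n!)^{3/2}·n^{−C} ≥ (n!)^{3/2}·e^{−c√n} as soon as n ≥ (4·max(C,1)/c)^4 (log n ≤ 4n^{1/4}).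
¬NoThresholdSubsetTriple: the target by push_neg. PROVED sorry-free in the repair planner's
Sketch.lean (`negativeSideResistance_proof`, axioms propext/Classic -/
@[route_item "route-MatrixMultiplication-SnSubsetDichotomy"]
def NegativeSideResistance : Prop :=
  (¬ GlobalBranch ∨ ¬ HyperoctahedralSubsets ∨ ¬ PolynomialSlack ∨ ¬ NoThresholdSubsetTriple) → ThresholdSubsetTriples

/-- item stmt-MatrixMultiplication-18340 · support · rank 9 · closed · proved by Summit.MatrixMultiplication.MatrixMultiplication.Theorems.subgroupHostedEdge_proof @ 378648f7ff27 (prover) · by planner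
sources: CohnKleinbergSzegedyUmans2005, BlasiakChurchCohnGrochowUmans2017
[support] glue, provable now (6 lines; planner Sketch.lean rc 0, axioms
propext/Classical.choice/Quot.sound: forget the hosts): ¬SubgroupHostedSubsets →
ThresholdSubsetTriples — the new crux's negative edge to `closes` (a refutation of
SubgroupHostedSubsets is a threshold design, hence ω(ℂ) = 2), the analogue of NegativeSideResistance
for the new rung. [difficulty: provable-now] -/
@[route_item "route-MatrixMultiplication-SnSubsetDichotomy"]
def SubgroupHostedEdge : Prop :=
  ¬ SubgroupHostedSubsets → ThresholdSubsetTriples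

/-- item stmt-MatrixMultiplication-5540 · support · rank 9 · closed · proved by Summit.MatrixMultiplication.MatrixMultiplication.Theorems.vershikKerovBound_proof (prover) · by planner
sources: VershikKerov1985, LoganShepp1977, JamesKerber1981
[support] known theorem, named-fact style, used only by the kill link (cite filed for vendoring into
Literature/RepresentationTheory): ∃ c > 0, n₀ with d_max(S_n) ≤ √(n!)·e^{−c√n} for n ≥ n₀
(VershikKerov1985 Thm 1, order-sharp two-sided bounds; hook formula + Logan–Shepp/Vershik–Kerov
limit shape). [difficulty: XL] -/
@[route_item "route-MatrixMultiplication-SnSubsetDichotomy", crux]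
def VershikKerovBound : Prop :=
  ∃ c : ℝ, 0 < c ∧ ∃ n₀ : ℕ, ∀ n ≥ n₀, (Literature.RepresentationTheory.FiniteGroups.maxCharDegree (Equiv.Perm (Fin n)) : ℝ) ≤ Real.sqrt (n.factorial : ℝ) * Real.exp (-(c * Real.sqrt (n : ℝ)))

/-- item stmt-MatrixMultiplication-8307 · support · rank 9 · closed · proved by Summit.MatrixMultiplication.MatrixMultiplication.Theorems.quotientSetDeficit_proof @ 3269aa11b8a0 (prover) · by planner
sources: BlasiakCohnGrochowPrattUmans2023, CohnUmans2003, lean:Literature.Computability.AlgebraicComplexity.RealizesTPP.mul_le_card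
[support] THE DEFICIT IDENTITY (card E0, dense form; any group): for a TPP triple with all three
sets non-empty the quotient sets S⁻¹T, T⁻¹U, U⁻¹S have full sizes |S||T|, |T||U|, |U||S|, and the
number of (a,b,c) ∈ S⁻¹T × T⁻¹U × U⁻¹S with abc = 1 is exactly |S||T||U| (cyclic invariance of the
TPP + unique representation). [difficulty: provable-now] -/
@[route_item "route-MatrixMultiplication-SnSubsetDichotomy"]
def QuotientSetDeficit : Prop :=
  ∀ (G : Type) [Group G] [DecidableEq G] (S T U : Finset G), Literature.Combinatorics.Additive.TripleProductProperty S T U → S.Nonempty → T.Nonempty → U.Nonempty → (Finset.image₂ (fun s t => s⁻¹ * t) S T).card = S.card * T.card ∧ (Finset.image₂ (fun t u => t⁻¹ * u) T U).card = T.card * U.card ∧ (Finset.image₂ (fun u s => u⁻¹ * s) U S).card = U.card * S.card ∧ ((Finset.image₂ (fun s t => s⁻¹ * t) S T ×ˢ Finset.image₂ (fun t u => t⁻¹ * u) T U ×ˢ Finset.image₂ (fun u s => u⁻¹ * s) U S).filter (fun x => x.1 * x.2.1 * x.2.2 = 1)).card = S.card * T.card * U.card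

/-- item stmt-MatrixMultiplication-8308 · support · rank 9 · closed · proved by Summit.MatrixMultiplication.MatrixMultiplication.Theorems.umvirateDescent_proof (prover) · by planner
sources: BlasiakChurchCohnGrochowUmans2017, lean:Literature.Combinatorics.Additive.TripleProductProperty.mono
[support] DESCENT BOOKKEEPING (card E2): for t ≤ n, injective t-tuples I, J, P (sources) and L
(common target) and a TPP triple (S,T,U) in S_n, there is a TPP triple in S_{n−t} with cardinalities
|S ∩ U_{I→L}|, |T ∩ U_{J→L}|, |U ∩ U_{P→L}| (right-translate each set so that the source becomes L,
land in the pointwise stabiliser of L ≅ S_{n−t}; TPP is hereditary and invariant under (S,T,U) ↦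
(Sa,Tb,Uc)). [difficulty: provable-now] -/
@[route_item "route-MatrixMultiplication-SnSubsetDichotomy"]
def UmvirateDescent : Prop :=
  ∀ n t : ℕ, t ≤ n → ∀ I J P L : Fin t → Fin n, Function.Injective I → Function.Injective J → Function.Injective P → Function.Injective L → ∀ S T U : Finset (Equiv.Perm (Fin n)), Literature.Combinatorics.Additive.TripleProductProperty S T U → ∃ S' T' U' : Finset (Equiv.Perm (Fin (n - t))), Literature.Combinatorics.Additive.TripleProductProperty S' T' U' ∧ S'.card = (S.filter (fun σ => ∀ k, σ (I k) = L k)).card ∧ T'.card = (T.filter (fun σ => ∀ k, σ (J k) = L k)).card ∧ U'.card = (U.filter (fun σ => ∀ k, σ (P k) = L k)).card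

/-- item stmt-MatrixMultiplication-8309 · support · rank 9 · closed · proved by Summit.MatrixMultiplication.MatrixMultiplication.Theorems.dichotomyInduction_proof (prover) · by planner
sources: BlasiakChurchCohnGrochowUmans2017, lean:Literature.Computability.AlgebraicComplexity.RealizesTPP.mul_le_card
[support] THE GLUE (provable now, elementary): GlobalBranch ∧ JuntaBranch ⇒ X. With ε, c₁, n₁ from
GlobalBranch put c₀ = min(c₁/2, 1/4) and run the potential Φ = (|S||T||U|/(n!)^{3/2})·e^{c₀√n}: the
packing bound (|S||T| ≤ n! etc., tree `RealizesTPP.mul_le_card`) gives Φ ≤ e^{c₀√n}; a bump-free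
stage contradicts GlobalBranch (e^{−c₁√n} < e^{−c₀√n}); otherwise JuntaBranch(ε, c₀) moves to n' ≥ n
− √n with Φ' ≥ e^{c₀+1−0.6c₀}Φ ≥ e·Φ (√n − √n' ≤ 0.6), so at most c₀√n steps occur and n stays ≥ n/2
≥ max(n₁, n₂); contradiction. Hence X with c = c₀, n₀ = 2·max(n₁, n₂(ε,c₀), 16). [difficulty:
provable-now] -/
@[route_item "route-MatrixMultiplication-SnSubsetDichotomy"]
def DichotomyInduction : Prop :=
  GlobalBranch → JuntaBranch → NoThresholdSubsetTriple

-- earlier Assembly (stmt-MatrixMultiplication-8310, replaced 2026-08-15T16:27:55Z -> stmt-MatrixMultiplication-10881): retired by None — ¬ NoThresholdSubsetTriple → Literature.Computability.AlgebraicComplexity.CKSU2005_cor19 → (∃ c : ℝ, 0 < c ∧ ∃ n₀ : ℕ, ∀ n ≥ n₀, (Literature.RepresentationTheory.FiniteGroups.maxCharDegree (Equiv.Perm (Fin n)) : ℝ) ≤ Real.sqrt (n.factorial : ℝ) * Real.exp (-(c * Rea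
/-- item stmt-MatrixMultiplication-10881 · assembly · rank 1 · closed · proved by Summit.MatrixMultiplication.MatrixMultiplication.Theorems.snSubsetDichotomy_assembly_proof @ 98a28b57767c (prover) · by planner
sources: CohnKleinbergSzegedyUmans2005, CohnUmans2003, VershikKerov1985, BlasiakChurchCohnGrochowUmans2017
[assembly] ThresholdSubsetTriples → VershikKerovBound → ω(ℂ) = 2 — the type of the deciding theorem
`closes` (D-0027 §2.1 repair 2026-08-15); replaces the former ¬NoThresholdSubsetTriple →
CKSU2005_cor19 → VK → MatrixMultiplication, whose hypotheses were not items. -/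
@[route_item "route-MatrixMultiplication-SnSubsetDichotomy"]
def Assembly : Prop :=
  ThresholdSubsetTriples → VershikKerovBound → MatrixMultiplication

-- records of items no longer active in this route (dropped / restated):
-- earlier HyperoctahedralThreshold (stmt-MatrixMultiplication-10883, dropped 2026-08-17T02:16:07Z): refuted by Summit.MatrixMultiplication.MatrixMultiplication.Theorems.not_HyperoctahedralThreshold @ c8e3065af9bd — ∀ c : ℝ, 0 < c → ∀ n₀ : ℕ, ∃ n ≥ n₀, ∃ μ : Fin 3 → Equiv.Perm (Fin n), (∀ i, μ i * μ i = 1 ∧ ∀ x, μ i x ≠ x) ∧ ∃ X : Fin 3 → Finset (Equiv.Perm (Fin n)), (∀ i, ∀ σ ∈ X i, σ * μ i = μ i * 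
-- earlier HyperoctahedralToThreshold (stmt-MatrixMultiplication-10884, dropped 2026-08-17T02:27:44Z): proved by Summit.MatrixMultiplication.MatrixMultiplication.Theorems.hyperoctahedralToThreshold_proof @ 3ffeb756c9fb — HyperoctahedralThreshold → ThresholdSubsetTriples

/-! D-0027 §2.1 — DECIDING THEOREM (planner-authored via `route open/edit --closes-file`; by planner-rfix-MatrixMultiplication-SnSubsetDi-6cc494d4-0 2026-08-17T02:14:50Z):
its hypotheses are this route's items and its conclusion the sub-problem Statement (glue_lint), and it elaborates with this file. -/

/-- DECIDING THEOREM (D-0027 §2.1) — the kill link of the symmetric-group subsets line: threshold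
TPP subset triples in `S_n` (the target) and the Vershik–Kerov bound
`d_max(S_n) ≤ √(n!)·e^{-c₁√n}` (support item `VershikKerovBound`; provable now from the tree theorem
`VershikKerov1985_maxCharDegree_holds` with `ε := vkUpperConst/2`) give `ω(ℂ) = 2` through the
Cohn–Umans inequality, CKSU 2005 Cor. 1.9, PROVED in the tree (`CKSU2005_cor19_holds`): if `ω > 2`
put `c := 3c₁(ω−2)/(2ω) > 0`; the target yields `n ≥ n₁` and a TPP triple with
`N := |S||T||U| > M := (n!)^{3/2}e^{−c√n}`; Cor. 1.9 and monotonicity give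
`N^{ω/3} ≤ d_max^{ω−2}·n! ≤ (√(n!)e^{−c₁√n})^{ω−2}·n!`; taking logarithms,
`(ω/3)(3/2·log n! − c√n) < (ω−2)(½ log n! − c₁√n) + log n!`, i.e. `c₁(ω−2)√n/2 < 0` — absurd.
Hence `ω ≤ 2`, and `2 ≤ ω` is `omega_two_le`. -/
@[closes "route-MatrixMultiplication-SnSubsetDichotomy"] theorem closes (hT : ThresholdSubsetTriples) (hVK : VershikKerovBound) : MatrixMultiplication := by
  rw [MatrixMultiplication_iff]
  refine le_antisymm (not_lt.1 fun hlt => ?_)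
    (Literature.Computability.AlgebraicComplexity.omega_two_le ℂ)
  -- Vershik–Kerov: d_max(S_n) ≤ √(n!)·exp(-c₁√n) for n ≥ n₁
  obtain ⟨c₁, hc₁, n₁, hn₁⟩ := hVK
  have hω0 : 0 < Literature.Computability.AlgebraicComplexity.omega ℂ := by linarith
  have hω2 : 0 < Literature.Computability.AlgebraicComplexity.omega ℂ - 2 := by linarith
  -- the slack constant fed to the target
  obtain ⟨n, hn, S, T, U, hTPP, hbig⟩ := hT
    (3 * c₁ * (Literature.Computability.AlgebraicComplexity.omega ℂ - 2) /
      (2 * Literature.Computability.AlgebraicComplexity.omega ℂ))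
    (by positivity) n₁
  -- Cohn–Umans (CKSU 2005 Cor. 1.9, tree theorem) for the realised triple ⟨|S|,|T|,|U|⟩ in S_n
  have hreal : Literature.Computability.AlgebraicComplexity.RealizesTPP (Equiv.Perm (Fin n))
      S.card T.card U.card := ⟨S, T, U, rfl, rfl, rfl, hTPP⟩
  have hCU := Literature.Computability.AlgebraicComplexity.CKSU2005_cor19_holds
    (Equiv.Perm (Fin n)) S.card T.card U.card hreal
  have hVKn := hn₁ n hn
  have hcard : (Nat.card (Equiv.Perm (Fin n)) : ℝ) = (n.factorial : ℝ) := by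
    rw [Nat.card_eq_fintype_card, Fintype.card_perm, Fintype.card_fin]
  rw [hcard] at hCU
  -- names
  set ω := Literature.Computability.AlgebraicComplexity.omega ℂ with hω
  set d : ℝ := (Literature.RepresentationTheory.FiniteGroups.maxCharDegree (Equiv.Perm (Fin n)) : ℝ)
    with hd
  set F : ℝ := (n.factorial : ℝ) with hF
  set s : ℝ := Real.sqrt (n : ℝ) with hs
  set N : ℝ := ((S.card * T.card * U.card : ℕ) : ℝ) with hN
  have hF0 : 0 < F := by rw [hF]; exact_mod_cast n.factorial_pos
  have hs0 : 0 ≤ s := Real.sqrt_nonneg _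
  have hd0 : 0 ≤ d := Nat.cast_nonneg _
  set D : ℝ := Real.sqrt F * Real.exp (-(c₁ * s)) with hD
  have hD0 : 0 < D := by positivity
  set c : ℝ := 3 * c₁ * (ω - 2) / (2 * ω) with hc
  set M : ℝ := F ^ ((3 : ℝ) / 2) * Real.exp (-(c * s)) with hM
  have hM0 : 0 < M := by positivity
  have hN0 : 0 < N := hM0.trans hbig
  -- upper bound: N^{ω/3} ≤ D^{ω-2} · n!
  have hup : N ^ (ω / 3) ≤ D ^ (ω - 2) * F := by
    refine hCU.trans ?_
    exact mul_le_mul_of_nonneg_right (Real.rpow_le_rpow hd0 hVKn hω2.le) hF0.le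
  -- logarithms of both bounds
  have hlogup : ω / 3 * Real.log N ≤ (ω - 2) * (Real.log F / 2 + -(c₁ * s)) + Real.log F := by
    have h1 : Real.log (N ^ (ω / 3)) ≤ Real.log (D ^ (ω - 2) * F) :=
      Real.log_le_log (Real.rpow_pos_of_pos hN0 _) hup
    rw [Real.log_rpow hN0, Real.log_mul (Real.rpow_pos_of_pos hD0 _).ne' hF0.ne',
      Real.log_rpow hD0, hD, Real.log_mul (Real.sqrt_pos.2 hF0).ne' (Real.exp_pos _).ne',
      Real.log_sqrt hF0.le, Real.log_exp] at h1
    exact h1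
  have hloglow : ω / 3 * Real.log M < ω / 3 * Real.log N :=
    mul_lt_mul_of_pos_left (Real.log_lt_log hM0 hbig) (by positivity)
  have hlogM : Real.log M = (3 : ℝ) / 2 * Real.log F + -(c * s) := by
    rw [hM, Real.log_mul (Real.rpow_pos_of_pos hF0 _).ne' (Real.exp_pos _).ne', Real.log_rpow hF0,
      Real.log_exp]
  rw [hlogM] at hloglow
  -- the arithmetic: ω·c/3 = c₁(ω-2)/2, so the two bounds force c₁(ω-2)√n/2 < 0
  have hkey : ω / 3 * (c * s) = c₁ * (ω - 2) * s / 2 := by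
    rw [hc]
    field_simp
  have hnn : 0 ≤ c₁ * (ω - 2) * s := mul_nonneg (mul_nonneg hc₁.le hω2.le) hs0
  nlinarith [hkey, hnn, hloglow, hlogup]

end Summit.MatrixMultiplication.MatrixMultiplication.Theses.SnSubsetDichotomy
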